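import Summits.Ventures.PercRepro.SixThreeCompose
import Summits.Ventures.PercRepro.SixThreeP1

/-!
# C-025 at `(6, 3)` from the profile tables alone: Theorem P₁′ discharged (p5, gen 7)

p2's `c025_six_three_of_P1_tables5` derives C-025 at `(6, 3)` on every finite matroid from Theorem P₁ (`hP₁`) and
p3's profile-table inequalities for the planes with `ρ(E ∖ G) ≤ 5` and `g ≥ 5`.  `supply_ge_three` (`SixThreeP1`)
is `hP₁` verbatim, so the per-triple hypothesis drops out of the interface: C-025 at `(6, 3)` now rests on the three
table hypotheses only.
-/

namespace PercRepro

namespace SixThree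

/-- **C-025 at `(6, 3)` on every finite matroid from the profile tables for `5 ≤ g`** — p2's
`c025_six_three_of_P1_tables5` with Theorem P₁′ (`P1.supply_ge_three`) discharged. -/
theorem c025_six_three_of_tables5 {α : Type} [DecidableEq α]
    (hT12 : ∀ (M : Matroid α) [M.Finite], ThmH.Simple M → (6 : ℕ∞) ≤ M.eRank →
      (M.eRank = 6 → ∀ e, ¬ M.IsColoop e) → ∀ G ∈ ThmH.planes M,
      M.eRk ((ThmH.gr M \ G : Finset α) : Set α) ≤ 5 → 5 ≤ G.card →
      TableIneqAdd12 G.card (prof M G))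
    (hT3gen : ∀ (M : Matroid α) [M.Finite], ThmH.Simple M → (6 : ℕ∞) ≤ M.eRank →
      (M.eRank = 6 → ∀ e, ¬ M.IsColoop e) → ∀ G ∈ ThmH.planes M,
      M.eRk ((ThmH.gr M \ G : Finset α) : Set α) ≤ 5 → 5 ≤ G.card →
      (∀ L ∈ linesOf M G, M.eRk ((G \ L : Finset α) : Set α) = 3) →
      3 * ((N3 G.card (prof M G) : ℚ) - C2gen G.card (prof M G)) ≤ FsumAdd 3 G.card (prof M G))
    (hT3two : ∀ (M : Matroid α) [M.Finite], ThmH.Simple M → (6 : ℕ∞) ≤ M.eRank →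
      (M.eRank = 6 → ∀ e, ¬ M.IsColoop e) → ∀ G ∈ ThmH.planes M,
      M.eRk ((ThmH.gr M \ G : Finset α) : Set α) ≤ 5 → 5 ≤ G.card →
      ∀ L₁ L₂, TwoLines M G L₁ L₂ → (∀ L ∈ linesOf M G, (L ∩ G).card + 2 ≤ G.card) →
      3 * ((N3 G.card (prof M G) : ℚ) - C2gen G.card (prof M G) + 2 * 2 ^ (L₁ ∩ L₂ ∩ G).card) ≤
        FsumAdd 3 G.card (prof M G))
    (M : Matroid α) [M.Finite] :
    phiK 6 3 * ({A : Set α | A ⊆ M.E ∧ M.eRk A = ((6 : ℕ) : ℕ∞) ∧ M.eRk (M.E \ A) = ((3 : ℕ) : ℕ∞)}.ncard : ℚ) ≤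
      ({A : Set α | A ⊆ M.E ∧ ((3 : ℕ) : ℕ∞) < M.eRk A ∧ M.eRk A < ((6 : ℕ) : ℕ∞)}.ncard : ℚ) :=
  c025_six_three_of_P1_tables5 (fun _ _ hs _ _ _ hG => P1.supply_ge_three hs hG) hT12 hT3gen hT3two M

end SixThree

end PercRepro
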